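import Summits.NavierStokesRegularity.NavierStokesRegularity.Theses.RigidMotionDoor
import Summits.NavierStokesRegularity.NavierStokesRegularity.Theorems.UnthreadedRigidityDoorAxisymEndLiouville
import HarnessLib

/-!
# RigidMotionDoor — support twin `AxisymEndLiouville` (item 27765), by name

The text is token-identical with the PROVED item of the Unthreaded-rigidity door (and SymmetryModuliCount 14061);
closed by `exact` on the tree theorem `unthreadedRigidityDoor_axisymEndLiouville_proof`.  Prover ns-imp-p1 g4.
WHAT THIS IS NOT: bookkeeping for a criterion door on HYPOTHETICAL Type-I profiles; NS regularity NOT proved.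
-/

set_option linter.dupNamespace false

namespace Summit.NavierStokesRegularity.NavierStokesRegularity.Theorems

/-- **Item 27765 `RigidMotionDoor.AxisymEndLiouville`** (twin of the Unthreaded-rigidity door's item), by name. -/
theorem rigidMotionDoor_axisymEndLiouville_proof : Theses.RigidMotionDoor.AxisymEndLiouville :=
  unthreadedRigidityDoor_axisymEndLiouville_proof

end Summit.NavierStokesRegularity.NavierStokesRegularity.Theorems
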